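import Literature.NumberTheory.GaloisRepresentations.IdeleTruncatedSFiniteComponents
import Literature.NumberTheory.GaloisRepresentations.IdeleBrauerLocalInvariantsDictionary
import Literature.NumberTheory.GaloisRepresentations.SemiLocalShapiroConjugation
import HarnessLib

/-!
# The local component of an idèle cohomology class at a place `w ∣ v`, read through Shapiro, is ONE pull-back along
# the pair `(Gal(E_w/F_v) ↪ Gal(E/F), x ↦ x_w)`; the same for classes from `Hⁿ(H, Res_H J_{E,S})` over `E^H`
# (Tate, C–F VII §7.2–§7.3; Brown III (6.2); Serre, *Galois Cohomology* I §2.4)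

Topic `NumberTheory/GaloisRepresentations`; namespace `Literature.NumberTheory.GaloisRepresentations.IdeleCohomology` (§1–§2)
and `…IdeleHerbrand` (§3).  Sequel to door-c5's `SemiLocalShapiro`/`SemiLocalShapiroConjugation` (`groupCohomologyUnitsRepIsoAut w n :
Hⁿ(Gal(E/F), ∏_{w'∣v} E_{w'}ˣ) ≅ Hⁿ(Gal(E_w/F_v), E_wˣ)`, `groupCohomologyUnitsRepIso_hom_eq`: Shapiro = `Hⁿ(G_w ↪ G, π_w)`),
door-c6's `IdeleBrauerLocalInvariantsDictionary` (`decompIncl w : Gal(E_w/F_v) →* Gal(E/F)`, `shapiro_placeProj_principal` — the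
PRINCIPAL-class case of §2) and this seat's `IdeleTruncatedSFiniteComponents` (`truncComponentClass`).  Two plumbing definitions
with bodies (the component morphisms) and theorems; no named fact, no instance, no notation, no `sorry`; number fields in `Type`.

* §1 **`idelePlaceComponentHom w : Res_{decompIncl w} J_E ⟶ E_wˣ`**, `x ↦ x_w` (a morphism of `Gal(E_w/F_v)`-modules), its
  formula `val_toMul_idelePlaceComponentHom_hom`.
* §2 **`placeProj_comp_shapiroAut_eq_map`**: `Hⁿ(id, π_v) ≫ Sh^{Aut}_w = Hⁿ(decompIncl w, x ↦ x_w)` on `Hⁿ(Gal(E/F), J_E)` — door-c6's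
  `shapiro_placeProj_principal` for ALL idèle classes — and its element form `shapiroAut_placeProj_eq_map_apply`.
* §3 for `H ≤ Gal(E/F)`, `L = E^H`, a place `w` of `E` over a finite place `u` of `L`: the plumbing pair
  **`truncLocGroupHom S H w : Gal(E_w/L_u) →* ↥H`** (`g ↦` the element of `H = Gal(E/L)` acting as `g` on `E ⊆ E_w`) and
  **`truncLocCoeffHom S H w : Res (Res_H J_{E,S}) ⟶ E_wˣ`** (`x ↦ x_w`), and
  **`shapiroAut_placeProj_truncComponentClass_eq_map`**: `Sh^{Aut}_w (Hⁿ(id, π_u) (truncComponentClass S H n c)) =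
  Hⁿ(truncLocGroupHom, truncLocCoeffHom) c` — the `u`-component of the image of `c ∈ Hⁿ(H, Res_H J_{E,S})`, read in
  `Hⁿ(Gal(E_w/L_u), E_wˣ)`, is ONE pull-back of `c` along an explicit pair (the shape in which it is compared with the
  local-layer datum `locLayerClass` of the `Ext` road, P2-e/P2-b(ii)).

HONEST FRAMING: functoriality bookkeeping (`groupCohomology.map_comp`, `map_congr'`); no arithmetic and no case of BSD /
Poitou–Tate is proved here.  Cell `bsd-eis`, crux `GoodLatticeBDPValue` (stmt-BirchSwinnertonDyer-19032), brick E3/[P2-mono]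
file P2-b, seat bsd-line-x1-p1-w8 g13.

## References
* J. W. S. Cassels, A. Fröhlich (eds.), *Algebraic Number Theory* (1967), Ch. VII (J. Tate) §7.2–§7.3. [CasselsFrohlichANT1967]
* K. S. Brown, *Cohomology of Groups*, GTM 87 (1982), III (6.2) (Shapiro). [Brown1982CohomologyGroups]
* J.-P. Serre, *Galois Cohomology* (1997), I §2.4 (compatible pairs). [SerreGaloisCohomology1997]
-/

noncomputable section

open NumberField IsDedekindDomain CategoryTheory CategoryTheory.Limits groupCohomology
open Literature.NumberTheory.Automorphic

namespace Literature.NumberTheory.GaloisRepresentations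

namespace IdeleCohomology

open SemiLocal Literature.Algebra.Homology

variable {F : Type} [Field F] [NumberField F] {E : Type} [Field E] [NumberField E] [Algebra F E] [IsGalois F E]
variable {v : HeightOneSpectrum (𝓞 F)}

/-! ## §1. The component morphism `x ↦ x_w` -/

/-- **`x ↦ x_w` as a morphism `Res_{decompIncl w} J_E ⟶ E_wˣ` of `Gal(E_w/F_v)`-modules**: door-c5's `π_v : J_E ⟶ ∏_{w'∣v} E_{w'}ˣ`
followed by the `w`-projection `unitsProjHom w`, read along `decompIncl w = G_w.subtype ∘ (decompMulEquiv w)⁻¹`.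
[cite: CasselsFrohlichANT1967, Ch. VII §7.2][cite: Brown1982CohomologyGroups, III (6.2)] -/
def idelePlaceComponentHom (w : Place F E v) :
    Rep.res (decompIncl w) (IdeleClassGroup.ideleRep F E) ⟶
      Rep.ofAlgebraAutOnUnits (v.adicCompletion F) ((w : HeightOneSpectrum (𝓞 E)).adicCompletion E) :=
  Rep.ofHom (LinearMap.intertwiningMap_of_isIntertwiningMap _ _
    ((unitsProjHom w).hom.toLinearMap ∘ₗ (placeProj (E := E) v).hom.toLinearMap) fun g x => by
      have e1 := LinearMap.congr_fun ((placeProj (E := E) v).hom.isIntertwining' (decompIncl w g)) x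
      have e2 := LinearMap.congr_fun ((unitsProjHom w).hom.isIntertwining' ((decompMulEquiv w).symm g))
        ((placeProj (E := E) v).hom.toLinearMap x)
      have h3 : decompHom w ((decompMulEquiv w).symm g) = g := by
        rw [decompHom_apply, ← decompMulEquiv_apply, MulEquiv.apply_symm_apply]
      have h4 : (localUnitsRep w).ρ ((decompMulEquiv w).symm g) =
          (Rep.ofAlgebraAutOnUnits (v.adicCompletion F) ((w : HeightOneSpectrum (𝓞 E)).adicCompletion E)).ρ g := by
        change (Rep.ofAlgebraAutOnUnits (v.adicCompletion F) ((w : HeightOneSpectrum (𝓞 E)).adicCompletion E)).ρ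
          (decompHom w ((decompMulEquiv w).symm g)) = _
        rw [h3]
      simp only [LinearMap.coe_comp, Function.comp_apply] at e1 e2 ⊢
      refine (congrArg (fun y => (unitsProjHom w).hom.toLinearMap y) e1).trans (e2.trans ?_)
      rw [h4]
      rfl)

/-- Formula: `idelePlaceComponentHom w x`, read in `E_w`, is the `w`-component of the idèle `x`.
[cite: CasselsFrohlichANT1967, Ch. VII §7.2] -/
theorem val_toMul_idelePlaceComponentHom_hom (w : Place F E v) (x : (IdeleClassGroup.ideleRep F E).V) :
    ((Additive.toMul ((idelePlaceComponentHom w).hom x) : ((w : HeightOneSpectrum (𝓞 E)).adicCompletion E)ˣ) :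
        (w : HeightOneSpectrum (𝓞 E)).adicCompletion E) =
      ((Additive.toMul x : ideleGroup E) : AdeleRing (𝓞 E) E).2 (w : HeightOneSpectrum (𝓞 E)) := rfl

/-! ## §2. Shapiro after the place projection is one pull-back -/

/-- **Bookkeeping over abstract representations**: `Hⁿ(id, φ) ≫ Hⁿ(e, ψ) ≫ Hⁿ(g, χ) = Hⁿ(f, θ)` when `f = e ∘ g` pointwise and
`θ = χ ∘ ψ ∘ φ` on vectors (Mathlib `groupCohomology.map_comp` + door-c5/c6 `map_congr'`; stated abstractly so that no concrete
representation is unfolded). [cite: SerreGaloisCohomology1997, I §2.4] -/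
theorem map_comp_map_comp_map_eq {K H G : Type} [Group K] [Group H] [Group G] {A A' : Rep ℤ K} {B : Rep ℤ H}
    {C : Rep ℤ G} (φ : A ⟶ A') (e : H →* K) (ψ : Rep.res e A' ⟶ B) (g : G →* H) (χ : Rep.res g B ⟶ C)
    (f : G →* K) (θ : Rep.res f A ⟶ C) (hf : ∀ x, f x = e (g x))
    (hθ : ∀ x : A.V, θ.hom x = χ.hom (ψ.hom (φ.hom x))) (n : ℕ) :
    groupCohomology.map (MonoidHom.id K) φ n ≫ groupCohomology.map e ψ n ≫ groupCohomology.map g χ n =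
      groupCohomology.map f θ n := by
  -- the `ℤ`-module structures carried by the `Rep` objects
  letI := A.hV2
  letI := C.hV2
  rw [← groupCohomology.map_comp, ← groupCohomology.map_comp]
  exact map_congr' (MonoidHom.ext fun x => (hf x).symm) _ _ (fun x => (hθ x).symm) n

/-- Element form of `map_comp_map_comp_map_eq`. [cite: SerreGaloisCohomology1997, I §2.4] -/
theorem map_map_map_eq_map_apply {K H G : Type} [Group K] [Group H] [Group G] {A A' : Rep ℤ K} {B : Rep ℤ H}
    {C : Rep ℤ G} (φ : A ⟶ A') (e : H →* K) (ψ : Rep.res e A' ⟶ B) (g : G →* H) (χ : Rep.res g B ⟶ C)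
    (f : G →* K) (θ : Rep.res f A ⟶ C) (hf : ∀ x, f x = e (g x))
    (hθ : ∀ x : A.V, θ.hom x = χ.hom (ψ.hom (φ.hom x))) (n : ℕ) (c : groupCohomology A n) :
    groupCohomology.map g χ n (groupCohomology.map e ψ n (groupCohomology.map (MonoidHom.id K) φ n c)) =
      groupCohomology.map f θ n c := by
  have h := congrArg (fun T => (ConcreteCategory.hom T) c) (map_comp_map_comp_map_eq φ e ψ g χ f θ hf hθ n)
  simpa only [ModuleCat.hom_comp, LinearMap.coe_comp, Function.comp_apply] using h

/-- **`Hⁿ(id, π_v) ≫ Sh^{Aut}_w = Hⁿ(decompIncl w, x ↦ x_w)`** on `Hⁿ(Gal(E/F), J_E)` (door-c5's `Sh_w = Hⁿ(G_w ↪ G, π_w)`,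
`groupCohomologyUnitsRepIso_hom_eq`, and Mathlib `groupCohomology.map_comp`); door-c6's `shapiro_placeProj_principal` is the
composite with `Eˣ → J_E`. [cite: CasselsFrohlichANT1967, Ch. VII §7.2][cite: Brown1982CohomologyGroups, III (6.2)] -/
theorem placeProj_comp_shapiroAut_eq_map (w : Place F E v) (n : ℕ) :
    groupCohomology.map (MonoidHom.id _) (placeProj (E := E) v) n ≫ (groupCohomologyUnitsRepIsoAut w n).hom =
      groupCohomology.map (decompIncl w) (idelePlaceComponentHom w) n := by
  rw [groupCohomologyUnitsRepIsoAut, Iso.trans_hom, groupCohomologyUnitsRepIso_hom_eq, groupCohomologyLocalUnitsRepIso,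
    groupCohomology.mapIso_hom, ← Category.assoc, ← groupCohomology.map_comp, ← groupCohomology.map_comp]
  refine map_congr' (MonoidHom.ext fun _ => rfl) _ _ (fun x => ?_) n
  refine Additive.toMul.injective (Units.ext ?_)
  rfl

/-- Element form. [cite: CasselsFrohlichANT1967, Ch. VII §7.2] -/
theorem shapiroAut_placeProj_eq_map_apply (w : Place F E v) (n : ℕ) (c : groupCohomology (IdeleClassGroup.ideleRep F E) n) :
    (groupCohomologyUnitsRepIsoAut w n).hom (groupCohomology.map (MonoidHom.id _) (placeProj (E := E) v) n c) =
      groupCohomology.map (decompIncl w) (idelePlaceComponentHom w) n c := by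
  have h := congrArg (fun T => (ConcreteCategory.hom T) c) (placeProj_comp_shapiroAut_eq_map (E := E) w n)
  simpa only [ModuleCat.hom_comp, LinearMap.coe_comp, Function.comp_apply] using h

end IdeleCohomology

/-! ## §3. The components of a class from `Hⁿ(H, Res_H J_{E,S})` over `E^H` -/

namespace IdeleHerbrand

open SemiLocal Literature.Algebra.Homology IdeleCohomology

variable {F : Type} [Field F] [NumberField F] {E : Type} [Field E] [NumberField E] [Algebra F E] [IsGalois F E]
variable (S : Finset (HeightOneSpectrum (𝓞 F))) (H : Subgroup (E ≃ₐ[F] E))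
variable {u : HeightOneSpectrum (𝓞 (IntermediateField.fixedField H))}

/-- **`Gal(E_w/L_u) →* H`** (`L = E^H`, `w ∣ u` a place of `E`): `decompIncl w : Gal(E_w/L_u) →* Gal(E/L)` followed by door-c5's
identification `Gal(E/L) ≃* H` (the inverse of `fixingSubgroupEquiv` / `subgroupCongr` used in `groupCohomologyResIdeleRepIso`).
[cite: CasselsFrohlichANT1967, Ch. VII §1.1][cite: SerreGaloisCohomology1997, I §2.4] -/
def truncLocGroupHom (w : Place (IntermediateField.fixedField H) E u) :
    (((w : HeightOneSpectrum (𝓞 E)).adicCompletion E) ≃ₐ[u.adicCompletion (IntermediateField.fixedField H)]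
        ((w : HeightOneSpectrum (𝓞 E)).adicCompletion E)) →* H :=
  ((MulEquiv.subgroupCongr (IntermediateField.fixingSubgroup_fixedField H).symm).trans
      (IntermediateField.fixingSubgroupEquiv (IntermediateField.fixedField H))).symm.toMonoidHom.comp (decompIncl w)

/-- Formula: `truncLocGroupHom S H w g`, as an automorphism of `E`, acts on `E ⊆ E_w` as `g`.
[cite: CasselsFrohlichANT1967, Ch. VII §1.1] -/
theorem coe_truncLocGroupHom_apply (w : Place (IntermediateField.fixedField H) E u)
    (g : ((w : HeightOneSpectrum (𝓞 E)).adicCompletion E) ≃ₐ[u.adicCompletion (IntermediateField.fixedField H)]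
        ((w : HeightOneSpectrum (𝓞 E)).adicCompletion E)) (x : E) :
    algebraMap E ((w : HeightOneSpectrum (𝓞 E)).adicCompletion E) (((truncLocGroupHom H w g : H) : E ≃ₐ[F] E) x) =
      g (algebraMap E _ x) :=
  coe_decompIncl_apply w g x

/-- **`x ↦ x_w` as a morphism `Res_{truncLocGroupHom} (Res_H J_{E,S}) ⟶ E_wˣ`** of `Gal(E_w/L_u)`-modules (the composite of
`truncInclHom`, door-c5's transport and `idelePlaceComponentHom w`, on vectors). [cite: CasselsFrohlichANT1967, Ch. VII §7.2] -/
def truncLocCoeffHom (w : Place (IntermediateField.fixedField H) E u) :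
    Rep.res (truncLocGroupHom H w) (Rep.res H.subtype (truncRep F E S)) ⟶
      Rep.ofAlgebraAutOnUnits (u.adicCompletion (IntermediateField.fixedField H))
        ((w : HeightOneSpectrum (𝓞 E)).adicCompletion E) :=
  Rep.ofHom (LinearMap.intertwiningMap_of_isIntertwiningMap _ _
    ((idelePlaceComponentHom (F := IntermediateField.fixedField H) w).hom.toLinearMap ∘ₗ
      (truncInclHom (E := E) S).hom.toLinearMap) fun g x => by
      have h := (idelePlaceComponentHom (F := IntermediateField.fixedField H) w).hom.isIntertwining' g
      have e := LinearMap.congr_fun h ((truncInclHom (E := E) S).hom.toLinearMap x)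
      simp only [LinearMap.coe_comp, Function.comp_apply] at e ⊢
      exact e)

/-- Formula: `truncLocCoeffHom S H w x`, read in `E_w`, is the `w`-component of the truncated idèle `x`.
[cite: CasselsFrohlichANT1967, Ch. VII §7.2] -/
theorem val_toMul_truncLocCoeffHom_hom (w : Place (IntermediateField.fixedField H) E u)
    (x : (truncRep F E S).V) :
    ((Additive.toMul ((truncLocCoeffHom S H w).hom x) : ((w : HeightOneSpectrum (𝓞 E)).adicCompletion E)ˣ) :
        (w : HeightOneSpectrum (𝓞 E)).adicCompletion E) =
      (((Additive.toMul x : truncIdeles F E S) : ideleGroup E) : AdeleRing (𝓞 E) E).2 (w : HeightOneSpectrum (𝓞 E)) := rfl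

/-- **The `u`-component of the image of `c ∈ Hⁿ(H, Res_H J_{E,S})`, read through Shapiro at `w ∣ u`, is ONE pull-back of `c`**:
`Sh^{Aut}_w (Hⁿ(id, π_u) (truncComponentClass S H n c)) = Hⁿ(truncLocGroupHom S H w, truncLocCoeffHom S H w) c`
(three `groupCohomology.map`s composed: `truncInclHom`, door-c5's transport `mapIso`, §2).
[cite: CasselsFrohlichANT1967, Ch. VII §7.2–§7.3][cite: SerreGaloisCohomology1997, I §2.4] -/
theorem shapiroAut_placeProj_truncComponentClass_eq_map (n : ℕ) (w : Place (IntermediateField.fixedField H) E u)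
    (c : groupCohomology (Rep.res H.subtype (truncRep F E S)) n) :
    (groupCohomologyUnitsRepIsoAut w n).hom
        (groupCohomology.map (MonoidHom.id _) (placeProj (E := E) u) n (truncComponentClass S H n c)) =
      groupCohomology.map (truncLocGroupHom H w) (truncLocCoeffHom S H w) n c := by
  rw [shapiroAut_placeProj_eq_map_apply]
  unfold truncComponentClass IdeleCohomology.groupCohomologyResIdeleRepIso
  rw [groupCohomology.mapIso_hom]
  refine IdeleCohomology.map_map_map_eq_map_apply _ _ _ _ _ (truncLocGroupHom H w) (truncLocCoeffHom S H w)
    (fun _ => rfl) (fun x => ?_) n c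
  rfl

end IdeleHerbrand

end Literature.NumberTheory.GaloisRepresentations

end
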